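import Mathlib
import Summits.ValiantsHypothesis.ValiantsHypothesis.Theorems.BarrierLeverPartitionMinorsHitByVPHiddenStatesCompleteBalls
import Summits.ValiantsHypothesis.ValiantsHypothesis.Theorems.BarrierLeverPartitionMinorsHitByVPSimplexJoinTwoWide

/-!
# Route BarrierLever — item `PartitionMinorsHitByVP` (stmt-ValiantsHypothesis-19717):
# CONJECTURE CB («complete Hamming balls with K = h are universal») IS FALSE — kernel refutation

Helper file (`--supports stmt-ValiantsHypothesis-19717`; cell valiant-natproofs, rung V4, 𝒟-side door (c), line
`hidden_states`; prover seat val-np-p3 gen 11). Definition-free. Closes NO item; settles the Theorems-side killable conjecture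
`HiddenStates.CompleteBallsUniversal` (`…HiddenStatesCompleteBalls`, val-np-p3 g8) in the NEGATIVE: `not_completeBallsUniversal`.

MECHANISM (the seat's packing / projection obstruction, memo §9–§10; kernel tools from `…SimplexJoinTwoWide`). Take `h = K = 33`,
`s = 2` (`|B₂(33)| = 562`) and rows `U = C ∪ V` with `C` = the 18 coordinates `≥ 15` and `V` among the subsets of size `≤ 3` of the
15 coordinates `< 15` (576 ≥ 562 of them). On the rows `⊇ C` every column is a scalar multiple (`∏_{a∈C}`) of its restriction to the
15 free coordinates, where the 34 star points `0, t_1, …, t_33 ∈ ℂ^{15}` split into two DISJOINT groups of 17 ≥ 15 + 2 points, each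
affinely dependent (`affineRelation_of_card`); the tensor of the two dependencies is supported on pairs `{g₁, g₂}` with `g₁, g₂` in
different groups — genuine ball points — and kills every row with `|V| ≤ 3` (`sum_sum_prod_eq_zero`). So for EVERY table the
additive matrix of this family against `B₂(33)` is singular, while CB asserts a nonsingular table. (Numerically CB already fails
at `h = 9` by a packing class with one symmetric relation, memo §10(b); `h = 33` is the smallest instance of the DISJOINT two-group
mechanism, which needs no dimension count beyond affine dependence.) Nothing on crux 14610 or VP ≠ VNP.
-/

set_option linter.dupNamespace false

namespace Summit.ValiantsHypothesis.ValiantsHypothesis.Theorems.BarrierLever.HiddenStates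

open Finset Matrix SimplexJoin

/-- The sets of size `≤ 2` in `Fin 33` number `562 = |B₂(33)|`. -/
theorem card_filter_card_le_two :
    (Finset.univ.filter fun J : Finset (Fin 33) => J.card ≤ 2).card = 562 := by
  have hdecomp : (Finset.univ.filter fun J : Finset (Fin 33) => J.card ≤ 2) =
      (Finset.range 3).biUnion fun j => Finset.powersetCard j (Finset.univ : Finset (Fin 33)) := by
    ext J
    simp only [Finset.mem_filter, Finset.mem_univ, true_and, Finset.mem_biUnion, Finset.mem_range,
      Finset.mem_powersetCard, Finset.subset_univ]
    constructor
    · intro hJ; exact ⟨J.card, by omega, rfl⟩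
    · rintro ⟨j, hj, hJ⟩; omega
  rw [hdecomp, Finset.card_biUnion]
  · simp only [Finset.card_powersetCard, Finset.card_univ, Fintype.card_fin]
    decide
  · exact (Finset.pairwise_disjoint_powersetCard _).set_pairwise _

/-- A ball–colex threshold family of size `562` on `33` states is exactly the complete ball `B₂(33)`. -/
theorem range_eq_ball (e : Fin 562 → Finset (Fin 33)) (he : Function.Injective e)
    (hthr : ∀ J, J ∉ Set.range e → ∀ i, ∑ k ∈ e i, ballWt 33 k < ∑ k ∈ J, ballWt 33 k) :
    ∀ J : Finset (Fin 33), J ∈ Set.range e ↔ J.card ≤ 2 := by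
  classical
  set T := Finset.univ.filter fun J : Finset (Fin 33) => J.card ≤ 2 with hT
  have hTc : T.card = 562 := card_filter_card_le_two
  have hIc : (Finset.univ.image e).card = 562 := by
    rw [Finset.card_image_of_injective _ he, Finset.card_univ, Fintype.card_fin]
  -- every member has size ≤ 2
  have hsub : Finset.univ.image e ⊆ T := by
    intro J hJ
    obtain ⟨k₀, -, rfl⟩ := Finset.mem_image.mp hJ
    rw [hT, Finset.mem_filter]
    refine ⟨Finset.mem_univ _, ?_⟩
    by_contra hbig
    push Not at hbig
    -- some J₀ of size ≤ 2 is missed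
    have hne : ¬ T ⊆ Finset.univ.image e := by
      intro hTI
      have hEq : T = Finset.univ.image e := Finset.eq_of_subset_of_card_le hTI (by rw [hTc, hIc])
      have : e k₀ ∈ T := by rw [hEq]; exact Finset.mem_image_of_mem e (Finset.mem_univ k₀)
      rw [hT, Finset.mem_filter] at this
      omega
    obtain ⟨J₀, hJ₀T, hJ₀I⟩ := Finset.not_subset.mp hne
    have hJ₀r : J₀ ∉ Set.range e := by
      rintro ⟨k, hk⟩
      exact hJ₀I (Finset.mem_image.mpr ⟨k, Finset.mem_univ _, hk⟩)
    have hlt := hthr J₀ hJ₀r k₀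
    rw [sum_ballWt, sum_ballWt] at hlt
    have hb := sum_two_pow_lt 33 J₀
    have hJ₀c : J₀.card ≤ 2 := (Finset.mem_filter.mp hJ₀T).2
    have h3 : 3 * 2 ^ 33 ≤ (e k₀).card * 2 ^ 33 := Nat.mul_le_mul_right _ hbig
    have h2 : J₀.card * 2 ^ 33 ≤ 2 * 2 ^ 33 := Nat.mul_le_mul_right _ hJ₀c
    omega
  have hEq : Finset.univ.image e = T := Finset.eq_of_subset_of_card_le hsub (by rw [hTc, hIc])
  intro J
  constructor
  · rintro ⟨k, rfl⟩
    have : e k ∈ T := hsub (Finset.mem_image_of_mem e (Finset.mem_univ k))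
    exact (Finset.mem_filter.mp this).2
  · intro hJ
    have : J ∈ Finset.univ.image e := by rw [hEq, hT, Finset.mem_filter]; exact ⟨Finset.mem_univ _, hJ⟩
    obtain ⟨k, -, hk⟩ := Finset.mem_image.mp this
    exact ⟨k, hk⟩

/-- The free coordinates `a < 15` and the core `C = {a ≥ 15}` of `Fin 33`. -/
theorem card_free : (Finset.univ.filter fun a : Fin 33 => (a : ℕ) < 15).card = 15 := by decide

/-- The row families: `576` subsets `V` of the free coordinates with `|V| ≤ 3`. -/
theorem card_smallFree :
    ((Finset.range 4).biUnion fun j =>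
      Finset.powersetCard j (Finset.univ.filter fun a : Fin 33 => (a : ℕ) < 15)).card = 576 := by
  rw [Finset.card_biUnion]
  · simp only [Finset.card_powersetCard, card_free]
    decide
  · exact (Finset.pairwise_disjoint_powersetCard _).set_pairwise _

/-- **THE WITNESS FAMILY IS BAD FOR `B₂(33)`.** Let `u i = C ∪ V_i` with `C = {a ≥ 15}` and the `V_i` distinct subsets of size
`≤ 3` of `{a < 15}`. Then for every ball–colex threshold family `e` of size 562 on 33 states (i.e. the complete ball `B₂(33)`) and
EVERY table `tx`, the additive matrix `[∏_{a ∈ u i} (tx none a + Σ_{q ∈ e k} tx (some q) a)]` is singular. -/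
theorem det_eq_zero_witness (V : Fin 562 → Finset (Fin 33))
    (hVfree : ∀ i, ∀ a ∈ V i, (a : ℕ) < 15) (hVcard : ∀ i, (V i).card ≤ 3)
    (e : Fin 562 → Finset (Fin 33)) (he : Function.Injective e)
    (hthr : ∀ J, J ∉ Set.range e → ∀ i, ∑ k ∈ e i, ballWt 33 k < ∑ k ∈ J, ballWt 33 k)
    (tx : Option (Fin 33) → Fin 33 → ℂ) :
    (Matrix.of fun i k : Fin 562 => ∏ a ∈ (Finset.univ.filter fun a : Fin 33 => 15 ≤ (a : ℕ)) ∪ V i,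
      (tx none a + ∑ q ∈ e k, tx (some q) a)).det = 0 := by
  classical
  set Cset : Finset (Fin 33) := Finset.univ.filter fun a : Fin 33 => 15 ≤ (a : ℕ) with hCset
  have hball := range_eq_ball e he hthr
  -- the point of a column and its core scalar
  let pt : Fin 562 → Fin 33 → ℂ := fun k a => tx none a + ∑ q ∈ e k, tx (some q) a
  let sc : Fin 562 → ℂ := fun k => ∏ a ∈ Cset, pt k a
  have hdisj : ∀ i, Disjoint Cset (V i) := by
    intro i
    rw [Finset.disjoint_left]
    intro a ha haV
    have := hVfree i a haV
    rw [hCset, Finset.mem_filter] at ha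
    omega
  have hentry : ∀ i k, (∏ a ∈ Cset ∪ V i, pt k a) = sc k * ∏ a ∈ V i, pt k a := fun i k =>
    Finset.prod_union (hdisj i)
  -- Case A: a column whose core scalar vanishes is a zero column
  by_cases hA : ∃ k, sc k = 0
  · obtain ⟨k, hk⟩ := hA
    refine Matrix.det_eq_zero_of_column_eq_zero k fun i => ?_
    simp only [Matrix.of_apply]
    change ∏ a ∈ Cset ∪ V i, pt k a = 0
    rw [hentry, hk, zero_mul]
  push Not at hA
  -- Case B: the two disjoint groups of star points and their affine dependencies on the free coordinates
  let G₁ : Finset (Option (Fin 33)) := Finset.insertNone (Finset.univ.filter fun q : Fin 33 => (q : ℕ) < 16)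
  let G₂ : Finset (Option (Fin 33)) := (Finset.univ.filter fun q : Fin 33 => 16 ≤ (q : ℕ)).image some
  let P : Option (Fin 33) → Fin 33 → ℂ := fun g a => g.elim 0 fun q => tx (some q) a
  -- restrict to free coordinates (zero elsewhere): then the dependencies hold at every coordinate
  let Pf : Option (Fin 33) → Fin 33 → ℂ := fun g a => if (a : ℕ) < 15 then P g a else 0
  let x15 : Option (Fin 33) → Fin 15 → ℂ := fun g b => P g (Fin.castLE (by norm_num) b)
  have hG₁ : 15 + 1 < G₁.card := by
    simp only [G₁, Finset.card_insertNone]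
    have : (Finset.univ.filter fun q : Fin 33 => (q : ℕ) < 16).card = 16 := by decide
    omega
  have hG₂ : 15 + 1 < G₂.card := by
    simp only [G₂]
    rw [Finset.card_image_of_injective _ (Option.some_injective _)]
    have : (Finset.univ.filter fun q : Fin 33 => 16 ≤ (q : ℕ)).card = 17 := by decide
    omega
  obtain ⟨Λ, hl0, hl1, g₁, hg₁, hΛ⟩ := affineRelation_of_card 15 G₁ x15 hG₁
  obtain ⟨Μ, hm0, hm1, g₂, hg₂, hΜ⟩ := affineRelation_of_card 15 G₂ x15 hG₂
  have hl1' : ∀ a : Fin 33, ∑ o ∈ G₁, Λ o * Pf o a = 0 := by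
    intro a
    by_cases ha : (a : ℕ) < 15
    · have := hl1 ⟨a, ha⟩
      simp only [x15] at this
      have hcast : Fin.castLE (by norm_num : 15 ≤ 33) ⟨a, ha⟩ = a := Fin.ext rfl
      rw [hcast] at this
      simpa [Pf, ha] using this
    · simp [Pf, ha]
  have hm1' : ∀ a : Fin 33, ∑ o ∈ G₂, Μ o * Pf o a = 0 := by
    intro a
    by_cases ha : (a : ℕ) < 15
    · have := hm1 ⟨a, ha⟩
      simp only [x15] at this
      have hcast : Fin.castLE (by norm_num : 15 ≤ 33) ⟨a, ha⟩ = a := Fin.ext rfl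
      rw [hcast] at this
      simpa [Pf, ha] using this
    · simp [Pf, ha]
  -- the ball point of a pair (g₁, g₂) ∈ G₁ × G₂ and its column
  let Jof : Option (Fin 33) × Option (Fin 33) → Finset (Fin 33) := fun gg => gg.1.toFinset ∪ gg.2.toFinset
  have hJcard : ∀ gg, (Jof gg).card ≤ 2 := by
    intro gg
    calc (Jof gg).card ≤ gg.1.toFinset.card + gg.2.toFinset.card := Finset.card_union_le _ _
      _ ≤ 1 + 1 := by
          gcongr
          · cases gg.1 <;> simp
          · cases gg.2 <;> simp
  have hG₁val : ∀ g ∈ G₁, ∀ q : Fin 33, g = some q → (q : ℕ) < 16 := by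
    intro g hg q hgq
    subst hgq
    simpa [G₁, Finset.mem_insertNone] using hg
  have hG₂val : ∀ g ∈ G₂, ∃ q : Fin 33, g = some q ∧ 16 ≤ (q : ℕ) := by
    intro g hg
    simp only [G₂, Finset.mem_image, Finset.mem_filter, Finset.mem_univ, true_and] at hg
    obtain ⟨q, hq, rfl⟩ := hg
    exact ⟨q, rfl, hq⟩
  have hJinj : ∀ gg ∈ G₁ ×ˢ G₂, ∀ gg' ∈ G₁ ×ˢ G₂, Jof gg = Jof gg' → gg = gg' := by
    intro gg hgg gg' hgg' hJ
    obtain ⟨h1, h2⟩ := Finset.mem_product.mp hgg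
    obtain ⟨h1', h2'⟩ := Finset.mem_product.mp hgg'
    obtain ⟨q₂, hq₂, hq₂v⟩ := hG₂val _ h2
    obtain ⟨q₂', hq₂', hq₂v'⟩ := hG₂val _ h2'
    -- the element ≥ 16 of Jof determines gg.2; the rest determines gg.1
    have hmem : ∀ (g g' : Option (Fin 33)) (q : Fin 33), q ∈ Jof (g, g') ↔ g = some q ∨ g' = some q := by
      intro g g' q
      simp only [Jof, Finset.mem_union, Option.mem_toFinset, Option.mem_def]
    have key : ∀ q : Fin 33, (gg.1 = some q ∨ gg.2 = some q) ↔ (gg'.1 = some q ∨ gg'.2 = some q) := by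
      intro q
      have := congrArg (fun J => q ∈ J) hJ
      simp only [eq_iff_iff] at this
      rw [show gg = (gg.1, gg.2) from rfl, show gg' = (gg'.1, gg'.2) from rfl] at this
      rwa [hmem, hmem] at this
    have e2 : gg.2 = gg'.2 := by
      rw [hq₂, hq₂']
      have := (key q₂).mp (Or.inr hq₂)
      rcases this with h | h
      · exact absurd (hG₁val _ h1' q₂ h) (by omega)
      · rw [← h, hq₂']
    have e1 : gg.1 = gg'.1 := by
      rcases hg : gg.1 with _ | q
      · rcases hg' : gg'.1 with _ | q'
        · rfl
        · have := (key q').mpr (Or.inl hg')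
          rw [hg] at this
          rcases this with h | h
          · exact absurd h (by simp)
          · rw [hq₂] at h
            have hlt := hG₁val _ h1' q' hg'
            have : q₂ = q' := Option.some_injective _ h
            omega
      · have := (key q).mp (Or.inl hg)
        rcases this with h | h
        · exact h.symm
        · rw [hq₂'] at h
          have hlt := hG₁val _ h1 q hg
          have : q₂' = q := Option.some_injective _ h
          omega
    exact Prod.ext e1 e2
  have hJpt : ∀ gg ∈ G₁ ×ˢ G₂, ∀ k, e k = Jof gg → ∀ a, pt k a = tx none a + P gg.1 a + P gg.2 a := by
    intro gg hgg k hk a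
    obtain ⟨h1, h2⟩ := Finset.mem_product.mp hgg
    obtain ⟨q₂, hq₂, hq₂v⟩ := hG₂val _ h2
    simp only [pt, hk, Jof]
    rcases hg : gg.1 with _ | q₁
    · simp [P, hq₂]
    · have hq₁v := hG₁val _ h1 q₁ hg
      have hne : q₁ ≠ q₂ := by intro h; subst h; omega
      rw [hq₂]
      simp only [Option.toFinset_some, P, Option.elim]
      rw [Finset.union_comm, ← Finset.insert_eq, Finset.sum_insert (by simpa using hne.symm), Finset.sum_singleton]
      ring
  -- the column of a pair
  have hcol : ∀ gg ∈ G₁ ×ˢ G₂, ∃ k, e k = Jof gg := fun gg _ => (hball (Jof gg)).mpr (hJcard gg)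
  -- the kernel vector
  let v : Fin 562 → ℂ := fun k => (∑ gg ∈ G₁ ×ˢ G₂, if e k = Jof gg then Λ gg.1 * Μ gg.2 else 0) / sc k
  have hvsum : ∀ k, ∑ gg ∈ G₁ ×ˢ G₂, (if e k = Jof gg then Λ gg.1 * Μ gg.2 else 0) =
      if h : ∃ gg ∈ G₁ ×ˢ G₂, e k = Jof gg then Λ h.choose.1 * Μ h.choose.2 else 0 := by
    intro k
    by_cases hk : ∃ gg ∈ G₁ ×ˢ G₂, e k = Jof gg
    · rw [dif_pos hk]
      have hgg := hk.choose_spec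
      rw [Finset.sum_eq_single hk.choose]
      · rw [if_pos hgg.2]
      · intro gg hgg' hne
        rw [if_neg]
        intro hk'
        exact hne (hJinj gg hgg' hk.choose hgg.1 (hk'.symm.trans hgg.2))
      · intro h; exact absurd hgg.1 h
    · rw [dif_neg hk]
      refine Finset.sum_eq_zero fun gg hgg => ?_
      rw [if_neg]
      intro hk'; exact hk ⟨gg, hgg, hk'⟩
  have hv : v ≠ 0 := by
    intro hv0
    have hgg : (g₁, g₂) ∈ G₁ ×ˢ G₂ := Finset.mem_product.mpr ⟨hg₁, hg₂⟩
    obtain ⟨k, hk⟩ := hcol (g₁, g₂) hgg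
    have := congrFun hv0 k
    simp only [v, Pi.zero_apply, div_eq_zero_iff] at this
    rcases this with h0 | h0
    · rw [Finset.sum_eq_single (g₁, g₂), if_pos hk] at h0
      · exact (mul_eq_zero.mp h0).elim hΛ hΜ
      · intro gg hgg' hne
        rw [if_neg]
        intro hk'
        exact hne (hJinj gg hgg' (g₁, g₂) hgg (hk'.symm.trans hk))
      · intro h; exact absurd hgg h
    · exact hA k h0
  apply (Matrix.exists_mulVec_eq_zero_iff).mp
  refine ⟨v, hv, funext fun i => ?_⟩
  simp only [Matrix.mulVec, dotProduct, Matrix.of_apply, Pi.zero_apply]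
  -- Σ_k (sc k · ∏_{V i} pt k) · v k = Σ_{gg} Λ Μ ∏_{V i} (τ + P g₁ + P g₂)
  have hVi : ∀ k a, a ∈ V i → pt k a = pt k a := fun _ _ _ => rfl
  calc ∑ k, (∏ a ∈ Cset ∪ V i, pt k a) * v k
      = ∑ k, (∏ a ∈ V i, pt k a) * ∑ gg ∈ G₁ ×ˢ G₂, (if e k = Jof gg then Λ gg.1 * Μ gg.2 else 0) := by
        refine Finset.sum_congr rfl fun k _ => ?_
        rw [hentry]
        simp only [v]
        field_simp [hA k]
    _ = ∑ k, ∑ gg ∈ G₁ ×ˢ G₂, (if e k = Jof gg then Λ gg.1 * Μ gg.2 * ∏ a ∈ V i, pt k a else 0) := by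
        refine Finset.sum_congr rfl fun k _ => ?_
        rw [Finset.mul_sum]
        refine Finset.sum_congr rfl fun gg _ => ?_
        split_ifs <;> ring
    _ = ∑ gg ∈ G₁ ×ˢ G₂, ∑ k, (if e k = Jof gg then Λ gg.1 * Μ gg.2 * ∏ a ∈ V i, pt k a else 0) := Finset.sum_comm
    _ = ∑ gg ∈ G₁ ×ˢ G₂, Λ gg.1 * Μ gg.2 * ∏ a ∈ V i, (tx none a + Pf gg.1 a + Pf gg.2 a) := by
        refine Finset.sum_congr rfl fun gg hgg => ?_
        obtain ⟨k, hk⟩ := hcol gg hgg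
        rw [Finset.sum_eq_single k]
        · rw [if_pos hk]
          congr 1
          refine Finset.prod_congr rfl fun a ha => ?_
          have ha15 := hVfree i a ha
          rw [hJpt gg hgg k hk a]
          simp [Pf, ha15]
        · intro k' _ hne
          rw [if_neg]
          intro hk'
          exact hne (he (hk'.trans hk.symm))
        · intro h; exact absurd (Finset.mem_univ k) h
    _ = ∑ o ∈ G₁, ∑ o' ∈ G₂, Λ o * Μ o' * ∏ a ∈ V i, (tx none a + Pf o a + Pf o' a) := Finset.sum_product _ _ _
    _ = 0 := sum_sum_prod_eq_zero G₁ G₂ Λ Μ Pf Pf (fun a => tx none a) hl0 hl1' hm0 hm1' (V i) (hVcard i)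

/-- **CONJECTURE CB IS FALSE.** `¬ CompleteBallsUniversal`: at `h = K = 33`, `s = 2` the injective family
`u i = {a ≥ 15} ∪ V_i` (`V_i` the subsets of size ≤ 3 of `{a < 15}`) is not `BallGood 33 33 562`. -/
theorem not_completeBallsUniversal : ¬ CompleteBallsUniversal := by
  classical
  intro H
  -- the rows
  set 𝒱 := (Finset.range 4).biUnion fun j =>
      Finset.powersetCard j (Finset.univ.filter fun a : Fin 33 => (a : ℕ) < 15) with h𝒱
  have hle : 562 ≤ 𝒱.card := by rw [card_smallFree]; norm_num
  let V : Fin 562 → Finset (Fin 33) := fun i => (𝒱.equivFin.symm (Fin.castLE hle i) : Finset (Fin 33))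
  have hVmem : ∀ i, V i ∈ 𝒱 := fun i => (𝒱.equivFin.symm (Fin.castLE hle i)).2
  have hVprop : ∀ i, (∀ a ∈ V i, (a : ℕ) < 15) ∧ (V i).card ≤ 3 := by
    intro i
    have hm := hVmem i
    rw [h𝒱, Finset.mem_biUnion] at hm
    obtain ⟨j, hj, hVj⟩ := hm
    rw [Finset.mem_powersetCard] at hVj
    refine ⟨fun a ha => ?_, by rw [hVj.2]; exact Nat.lt_succ_iff.mp (Finset.mem_range.mp hj)⟩
    have := hVj.1 ha
    exact (Finset.mem_filter.mp this).2
  have hVinj : Function.Injective V := by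
    intro i i' hii'
    have := 𝒱.equivFin.symm.injective (Subtype.ext hii')
    exact Fin.castLE_injective hle this
  set Cset : Finset (Fin 33) := Finset.univ.filter fun a : Fin 33 => 15 ≤ (a : ℕ) with hCset
  let u : Fin 562 → Finset (Fin 33) := fun i => Cset ∪ V i
  have hu : Function.Injective u := by
    intro i i' hii'
    apply hVinj
    have hdis : ∀ i, Disjoint Cset (V i) := fun i => by
      rw [Finset.disjoint_left]; intro a ha haV
      have := (hVprop i).1 a haV
      rw [hCset, Finset.mem_filter] at ha; omega
    have h1 : V i = (Cset ∪ V i) \ Cset := by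
      rw [Finset.union_sdiff_left, eq_comm, Finset.sdiff_eq_self_iff_disjoint]; exact (hdis i).symm
    have h2 : V i' = (Cset ∪ V i') \ Cset := by
      rw [Finset.union_sdiff_left, eq_comm, Finset.sdiff_eq_self_iff_disjoint]; exact (hdis i').symm
    rw [h1, h2]
    exact congrArg (· \ Cset) hii'
  have hcard : ballCard 33 2 = 562 := by decide
  have hgood : BallGood 33 33 562 u := by
    have := H 33 2 (by norm_num) (by norm_num)
    rw [hcard] at this
    exact this u hu
  obtain ⟨e, he, hthr⟩ := exists_ballColex 33 562 (by norm_num)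
  obtain ⟨tx, htx⟩ := hgood e he hthr
  exact htx (det_eq_zero_witness V (fun i => (hVprop i).1) (fun i => (hVprop i).2) e he hthr tx)

end Summit.ValiantsHypothesis.ValiantsHypothesis.Theorems.BarrierLever.HiddenStates
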